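import Summits.Ventures.PercRepro.Night4T6C6Q8M0Z
import Summits.Ventures.PercRepro.Night4T6C7Q8M0Z
import Summits.Ventures.PercRepro.Night4T6C8Q8M0Z
import Summits.Ventures.PercRepro.Night4T6C22Q8M0Z
import Summits.Ventures.PercRepro.Night4T6C23Q8M0Z
import Summits.Ventures.PercRepro.Night4T6C24Q8M0Z
import Summits.Ventures.PercRepro.Night4T6C25Q8M0Z
import Summits.Ventures.PercRepro.Night4T6C26Q8M0Z
import Summits.Ventures.PercRepro.Night4T6C27Q8M0Z
import Summits.Ventures.PercRepro.Night4T6C28Q8M0Z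
import Summits.Ventures.PercRepro.Night4T6C29Q8M0Z
import Summits.Ventures.PercRepro.Night4T6C30Q8M0Z
import Summits.Ventures.PercRepro.Night4T6C31Q8M0Z
import Summits.Ventures.PercRepro.Night4T6C32Q8M0Z
import Summits.Ventures.PercRepro.Night4T6C33Q8M0Z
import Summits.Ventures.PercRepro.Night4T6C34Q8M0Z
import Summits.Ventures.PercRepro.Night4T6C35Q8M0Z
import Summits.Ventures.PercRepro.Night4T6C40Q8M0Z
import Summits.Ventures.PercRepro.Night4T6C41Q8M0Z
import Summits.Ventures.PercRepro.Night4T6C43Q8M0Z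
import Summits.Ventures.PercRepro.GenQTenEightResidue
import Summits.Ventures.PercRepro.GenQTenEightGap

/-!
# PercRepro — the `(10, 8)` row: the type-`6` residue assembled (night-4, gen 19 — modulo the gap of GenQTenEightGap; the certified case modules to land)
`jq_t6_residue_eight_of_gap` assembles the certificates `jq_t6_nonneg_c{d}_q8_m0` over the coranks `6 … 62` of `HighLayersEightResidue` at type `6`, the gap coranks (`typeGapEight`) taken from `HighLayersEightResidual`.
-/
namespace PercRepro.Night4

open Finset ThmH SixFour GenQ PerFlat Star NightThree ThmN

variable {α : Type} [DecidableEq α] {M : Matroid α} [M.Finite]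

/-- **The type-`6` residue of `HighLayersEightResidue` modulo the gap**: the coranks `6 … 62` — a plain-row certificate where one exists (the tree theorems `jq_t6_nonneg_c{d}_q8_m0`), the residual hypothesis `hres` on the `37` gap cases of `typeGapEight`. -/
theorem jq_t6_residue_eight_of_gap (hres : HighLayersEightResidual) (hs : Simple M) (hline : ∀ L ∈ flatsQ M 2, L.card ≤ 3) (hplane : ∀ P ∈ flatsQ M 3, P.card ≤ 6) (hsolid : ∀ F ∈ flatsQ M 4, F.card ≤ 10) (hflat5 : ∀ F ∈ flatsQ M 5, F.card ≤ 21) (hflat6 : ∀ F ∈ flatsQ M 6, F.card ≤ 43) (hflat7 : ∀ F ∈ flatsQ M 7, F.card ≤ 87) {G : Finset α} (hc : Core M 10) (hGf : G ∈ flatsQ M 8) (hF : TwoHyp M G 8) (hG : G ⊆ gr M) (hrG : M.eRk (G : Set α) = ((8 : ℕ) : ℕ∞)) (hmG : mTr M G = 0) (hlo : 8 + 6 ≤ G.card) (hhi : G.card < 71) : 0 ≤ Jq M G 8 6 := by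
  obtain ⟨d, hd⟩ : ∃ d, G.card = 8 + d := ⟨G.card - 8, by omega⟩
  have h1 : 6 ≤ d := by omega
  have h2 : d ≤ 62 := by omega
  interval_cases d
  · exact jq_t6_nonneg_c6_q8_m0 hs hline hplane hsolid hflat5 hflat6 hflat7 hG hrG hd hmG
  · exact jq_t6_nonneg_c7_q8_m0 hs hline hplane hsolid hflat5 hflat6 hflat7 hG hrG hd hmG
  · exact jq_t6_nonneg_c8_q8_m0 hs hline hplane hsolid hflat5 hflat6 hflat7 hG hrG hd hmG
  · exact hres M G hc hGf hF hmG 6 9 (by decide) hd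
  · exact hres M G hc hGf hF hmG 6 10 (by decide) hd
  · exact hres M G hc hGf hF hmG 6 11 (by decide) hd
  · exact hres M G hc hGf hF hmG 6 12 (by decide) hd
  · exact hres M G hc hGf hF hmG 6 13 (by decide) hd
  · exact hres M G hc hGf hF hmG 6 14 (by decide) hd
  · exact hres M G hc hGf hF hmG 6 15 (by decide) hd
  · exact hres M G hc hGf hF hmG 6 16 (by decide) hd
  · exact hres M G hc hGf hF hmG 6 17 (by decide) hd
  · exact hres M G hc hGf hF hmG 6 18 (by decide) hd
  · exact hres M G hc hGf hF hmG 6 19 (by decide) hd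
  · exact hres M G hc hGf hF hmG 6 20 (by decide) hd
  · exact hres M G hc hGf hF hmG 6 21 (by decide) hd
  · exact jq_t6_nonneg_c22_q8_m0 hs hline hplane hsolid hflat5 hflat6 hflat7 hG hrG hd hmG
  · exact jq_t6_nonneg_c23_q8_m0 hs hline hplane hsolid hflat5 hflat6 hflat7 hG hrG hd hmG
  · exact jq_t6_nonneg_c24_q8_m0 hs hline hplane hsolid hflat5 hflat6 hflat7 hG hrG hd hmG
  · exact jq_t6_nonneg_c25_q8_m0 hs hline hplane hsolid hflat5 hflat6 hflat7 hG hrG hd hmG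
  · exact jq_t6_nonneg_c26_q8_m0 hs hline hplane hsolid hflat5 hflat6 hflat7 hG hrG hd hmG
  · exact jq_t6_nonneg_c27_q8_m0 hs hline hplane hsolid hflat5 hflat6 hflat7 hG hrG hd hmG
  · exact jq_t6_nonneg_c28_q8_m0 hs hline hplane hsolid hflat5 hflat6 hflat7 hG hrG hd hmG
  · exact jq_t6_nonneg_c29_q8_m0 hs hline hplane hsolid hflat5 hflat6 hflat7 hG hrG hd hmG
  · exact jq_t6_nonneg_c30_q8_m0 hs hline hplane hsolid hflat5 hflat6 hflat7 hG hrG hd hmG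
  · exact jq_t6_nonneg_c31_q8_m0 hs hline hplane hsolid hflat5 hflat6 hflat7 hG hrG hd hmG
  · exact jq_t6_nonneg_c32_q8_m0 hs hline hplane hsolid hflat5 hflat6 hflat7 hG hrG hd hmG
  · exact jq_t6_nonneg_c33_q8_m0 hs hline hplane hsolid hflat5 hflat6 hflat7 hG hrG hd hmG
  · exact jq_t6_nonneg_c34_q8_m0 hs hline hplane hsolid hflat5 hflat6 hflat7 hG hrG hd hmG
  · exact jq_t6_nonneg_c35_q8_m0 hs hline hplane hsolid hflat5 hflat6 hflat7 hG hrG hd hmG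
  · exact hres M G hc hGf hF hmG 6 36 (by decide) hd
  · exact hres M G hc hGf hF hmG 6 37 (by decide) hd
  · exact hres M G hc hGf hF hmG 6 38 (by decide) hd
  · exact hres M G hc hGf hF hmG 6 39 (by decide) hd
  · exact jq_t6_nonneg_c40_q8_m0 hs hline hplane hsolid hflat5 hflat6 hflat7 hG hrG hd hmG
  · exact jq_t6_nonneg_c41_q8_m0 hs hline hplane hsolid hflat5 hflat6 hflat7 hG hrG hd hmG
  · exact hres M G hc hGf hF hmG 6 42 (by decide) hd
  · exact jq_t6_nonneg_c43_q8_m0 hs hline hplane hsolid hflat5 hflat6 hflat7 hG hrG hd hmG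
  · exact hres M G hc hGf hF hmG 6 44 (by decide) hd
  · exact hres M G hc hGf hF hmG 6 45 (by decide) hd
  · exact hres M G hc hGf hF hmG 6 46 (by decide) hd
  · exact hres M G hc hGf hF hmG 6 47 (by decide) hd
  · exact hres M G hc hGf hF hmG 6 48 (by decide) hd
  · exact hres M G hc hGf hF hmG 6 49 (by decide) hd
  · exact hres M G hc hGf hF hmG 6 50 (by decide) hd
  · exact hres M G hc hGf hF hmG 6 51 (by decide) hd
  · exact hres M G hc hGf hF hmG 6 52 (by decide) hd
  · exact hres M G hc hGf hF hmG 6 53 (by decide) hd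
  · exact hres M G hc hGf hF hmG 6 54 (by decide) hd
  · exact hres M G hc hGf hF hmG 6 55 (by decide) hd
  · exact hres M G hc hGf hF hmG 6 56 (by decide) hd
  · exact hres M G hc hGf hF hmG 6 57 (by decide) hd
  · exact hres M G hc hGf hF hmG 6 58 (by decide) hd
  · exact hres M G hc hGf hF hmG 6 59 (by decide) hd
  · exact hres M G hc hGf hF hmG 6 60 (by decide) hd
  · exact hres M G hc hGf hF hmG 6 61 (by decide) hd
  · exact hres M G hc hGf hF hmG 6 62 (by decide) hd

end PercRepro.Night4
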